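import Summits.AtomisticToContinuum.Crystallization.Theorems.ChartedZeroExcessLayeredLatticeLiouvilleZZZOA

/-!
# ChartedZeroExcess · LayeredLatticeLiouville ZZZO «BondPieces: consumer pieces / distance dichotomy / star homomorphism» (lens-2 g83) — part 2 of 2 (sequel of `…ChartedZeroExcessLayeredLatticeLiouvilleZZZOA`)

Split for the 400-line cap by the landing lane (hand-2 g40); the module docstring of part 1 (`…ChartedZeroExcessLayeredLatticeLiouvilleZZZOA`) describes the whole node.  Same namespace; all FQNs unchanged.
0 sorry; standard axioms.
-/

noncomputable section
open scoped BigOperators Classical InnerProductSpace RealInnerProductSpace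
open MeasureTheory Set Metric Filter Topology
open Literature.Geometry.DiscreteGeometry (IsTwoShellGoodSet fccTwoShellPattern hcpTwoShellPattern norm_of_mem_fccTwoShellPattern
  norm_of_mem_hcpTwoShellPattern)
open Literature.MathematicalPhysics.StatisticalMechanics (lennardJones)

namespace Summit.AtomisticToContinuum.Crystallization.Theorems.ChartedZeroExcessLayeredLatticeLiouville

open Summit.AtomisticToContinuum.Crystallization.Theorems.ChartedPlanarOrderRigidityDoor (E3 IsClean)
open Summit.AtomisticToContinuum.Crystallization.Theorems.ChartedPlanarOrderDensityDichotomy (μS IsSep)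
open Summit.AtomisticToContinuum.Crystallization.Theorems.ChartedPlanarOrderCleanScaleP (IsCleanP IsDoorSetP isCleanP_μS_iff)
open Summit.AtomisticToContinuum.Crystallization.Theorems.ChartedPlanarOrderMesoCut (LayeredHom EnvClose)
open Summit.AtomisticToContinuum.Crystallization.Theorems.ChartedPlanarOrderDoorLayeredOsc (IsTwoShellAffineGood)

/-! ### ZZZO-2  The distance dichotomy of a two-shell-good set -/

/-- ★ in a `(θ, aLo, aHi)`-two-shell-good set at `q` (`0 ≤ θ ≤ 1`, `0 < aLo`): every other site is at distance `≥ aLo(1 − θ)`; a site within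
`3/2·aLo` is FIRST SHELL (`≤ aHi(1 + θ)`) or SECOND SHELL (`≥ aLo(√2 − θ)`). [this file, g83] -/
theorem dist_dichotomy_of_good {θ aLo aHi : ℝ} {Y : Set E3} {q y : E3} (hgood : IsTwoShellGoodSet θ aLo aHi Y q) (hθ0 : 0 ≤ θ)
    (hθ1 : θ ≤ 1) (haLo : 0 < aLo) (hy : y ∈ Y) (hne : y ≠ q) (hd : dist y q ≤ 3 / 2 * aLo) :
    aLo * (1 - θ) ≤ dist y q ∧ (dist y q ≤ aHi * (1 + θ) ∨ aLo * (Real.sqrt 2 - θ) ≤ dist y q) := by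
  obtain ⟨a, haLo', haHi, A, P, f, hP, hf, -, hcov⟩ := hgood
  have ha : 0 < a := lt_of_lt_of_le haLo haLo'
  have h1 : (1 : ℝ) ≤ Real.sqrt 2 := Real.one_le_sqrt.mpr (by norm_num)
  obtain ⟨v, hvP, hfv⟩ := hcov y hy hne (by nlinarith)
  have hmv := (hf v hvP).2
  rw [hfv] at hmv
  obtain ⟨hup, hdown⟩ := dist_matched_le ha.le hmv
  have hnv : ‖v‖ = 1 ∨ ‖v‖ = Real.sqrt 2 := by
    rcases hP with rfl | rfl
    · exact norm_of_mem_fccTwoShellPattern hvP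
    · exact norm_of_mem_hcpTwoShellPattern hvP
  rcases hnv with hn | hn
  · rw [hn, mul_one] at hup hdown
    refine ⟨by nlinarith, Or.inl (by nlinarith)⟩
  · rw [hn] at hup hdown
    have hlo2 : aLo * (Real.sqrt 2 - θ) ≤ dist y q := by
      nlinarith [mul_le_mul_of_nonneg_right haLo' (show (0 : ℝ) ≤ Real.sqrt 2 - θ by linarith)]
    refine ⟨?_, Or.inr hlo2⟩
    nlinarith [mul_le_mul_of_nonneg_left (show (1 : ℝ) - θ ≤ Real.sqrt 2 - θ by linarith) haLo.le]

/-- local separation of a two-shell-good set: every other site is at distance `≥ aLo(1 − θ)` (`3/2 ≥ 1 − θ`). [this file, g83] -/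
theorem le_dist_of_good {θ aLo aHi : ℝ} {Y : Set E3} {q y : E3} (hgood : IsTwoShellGoodSet θ aLo aHi Y q) (hθ0 : 0 ≤ θ) (hθ1 : θ ≤ 1)
    (haLo : 0 < aLo) (hy : y ∈ Y) (hne : y ≠ q) : aLo * (1 - θ) ≤ dist y q := by
  by_cases hd : dist y q ≤ 3 / 2 * aLo
  · exact (dist_dichotomy_of_good hgood hθ0 hθ1 haLo hy hne hd).1
  · push Not at hd
    nlinarith

/-- ★ BONDS OF THE PLACED CRYSTAL FROM PERTURBED BOND LENGTHS (record constants): in a `(1/15, 8999/10000, 1)`-good `C`, two distinct sites at distance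
`≤ 28/25 + 2η`, `η ≤ 1/25`, are bonded (`1.12 + 0.08 = 1.2 < 0.8999·(√2 − 1/15) = 1.2126`, first shell `≤ 16/15 ≤ 28/25`). [this file, g83] -/
theorem isBond_of_near_record {C : Set E3} {c c' : E3} {η : ℝ} (hgood : IsTwoShellGoodSet (1 / 15) (8999 / 10000) 1 C c) (hc' : c' ∈ C)
    (hne : c' ≠ c) (hη : η ≤ 1 / 25) (hd : dist c c' ≤ 28 / 25 + 2 * η) : IsBond c c' := by
  obtain ⟨hl, -⟩ := sqrt_two_bounds
  rw [dist_comm] at hd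
  obtain ⟨hsep, hcase⟩ := dist_dichotomy_of_good hgood (by norm_num) (by norm_num) (by norm_num) hc' hne (by linarith)
  refine ⟨by rw [dist_comm]; linarith, ?_⟩
  rw [dist_comm]
  rcases hcase with h | h
  · linarith
  · exfalso; linarith

/-! ### ZZZO-3  ★ A near index map is a star homomorphism; near values coincide -/

/-- two `C`-sites within `ε` resp. `η` of the same point coincide when `ε + η < 0.8399 ≤` the local separation of `C`. [this file, g83] -/
theorem eq_of_near_record {C : Set E3} {p c c' : E3} {ε η : ℝ} (hgood : IsTwoShellGoodSet (1 / 15) (8999 / 10000) 1 C c) (hc' : c' ∈ C)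
    (hd : dist p c ≤ ε) (hd' : dist p c' ≤ η) (hεη : ε + η < 8399 / 10000) : c' = c := by
  by_contra hne
  have h := le_dist_of_good hgood (by norm_num) (by norm_num) (by norm_num) hc' hne
  have h2 : dist c' c ≤ ε + η := by linarith [dist_triangle_left c' c p, dist_comm p c']
  norm_num at h
  linarith

/-- ★ AGREEMENT FROM NEARNESS: if `Φ (f x)` is within `ε` and `Φ (f' x)` within `η` of `Ψ x` (`ε + η < 0.8399`), then `f x = f' x`. [this file, g83] -/
theorem agree_of_near {C : Set E3} {Ψ Φ : ℤ × ℤ × ℤ → E3} {τC : ℤ → Bool} {f f' : ℤ × ℤ × ℤ → ℤ × ℤ × ℤ} {x : ℤ × ℤ × ℤ} {ε η : ℝ}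
    (hΦ : IsBarlowBondChart C Set.univ Φ τC) (hgoodC : ∀ c ∈ C, IsTwoShellGoodSet (1 / 15) (8999 / 10000) 1 C c)
    (hfx : dist (Ψ x) (Φ (f x)) ≤ ε) (hf'x : dist (Ψ x) (Φ (f' x)) ≤ η) (hεη : ε + η < 8399 / 10000) : f x = f' x := by
  have hC : Φ (f x) ∈ C := hΦ.2.1 (mem_univ _)
  have hC' : Φ (f' x) ∈ C := hΦ.2.1 (mem_univ _)
  exact (hΦ.1 (mem_univ _) (mem_univ _) (eq_of_near_record (hgoodC _ hC) hC' hfx hf'x hεη)).symm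

/-- bonded atoms with `η`-near sites have bonded sites (record constants: `S` `(1/16, 9/10, 1)`-clean, `C` `(1/15, 8999/10000, 1)`-clean, `η ≤ 1/25`).
[this file, g83] -/
theorem barlowAdj_of_near {S C : Set E3} {Ψ Φ : ℤ × ℤ × ℤ → E3} {τS τC : ℤ → Bool} {f' : ℤ × ℤ × ℤ → ℤ × ℤ × ℤ} {u v : ℤ × ℤ × ℤ} {η : ℝ}
    (hΨ : IsBarlowBondChart S Set.univ Ψ τS) (hΦ : IsBarlowBondChart C Set.univ Φ τC)
    (hgoodS : ∀ p ∈ S, IsTwoShellGoodSet (1 / 16) (9 / 10) 1 S p) (hgoodC : ∀ c ∈ C, IsTwoShellGoodSet (1 / 15) (8999 / 10000) 1 C c)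
    (hη : η ≤ 1 / 25) (hu : dist (Ψ u) (Φ (f' u)) ≤ η) (hv : dist (Ψ v) (Φ (f' v)) ≤ η) (hadj : BarlowAdj τS u v) :
    BarlowAdj τC (f' u) (f' v) := by
  have hb : IsBond (Ψ u) (Ψ v) := (hΨ.2.2 u (mem_univ _) v (mem_univ _)).2 hadj
  have hne : Ψ v ≠ Ψ u := fun e => by have := hb.1; rw [e, dist_self] at this; exact lt_irrefl _ this
  have hsep := le_dist_of_good (hgoodS _ (hΨ.2.1 (mem_univ u))) (by norm_num) (by norm_num) (by norm_num) (hΨ.2.1 (mem_univ v)) hne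
  have hup : dist (Φ (f' u)) (Φ (f' v)) ≤ 28 / 25 + 2 * η := by linarith [dist_le_of_partners hu hv, hb.2]
  have hlo : dist (Ψ u) (Ψ v) ≤ dist (Φ (f' u)) (Φ (f' v)) + 2 * η := dist_ge_of_partners hu hv
  have hne' : Φ (f' v) ≠ Φ (f' u) := by
    intro e
    rw [e, dist_self, dist_comm] at hlo
    norm_num at hsep
    linarith
  exact (hΦ.2.2 (f' u) (mem_univ _) (f' v) (mem_univ _)).1
    (isBond_of_near_record (hgoodC _ (hΦ.2.1 (mem_univ _))) (hΦ.2.1 (mem_univ _)) hne' hη hup)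

/-- distinct atoms with `η`-near sites have distinct sites. [this file, g83] -/
theorem ne_of_near {S : Set E3} {Ψ Φ : ℤ × ℤ × ℤ → E3} {τS : ℤ → Bool} {f' : ℤ × ℤ × ℤ → ℤ × ℤ × ℤ} {u v : ℤ × ℤ × ℤ} {η : ℝ}
    (hΨ : IsBarlowBondChart S Set.univ Ψ τS)
    (hgoodS : ∀ p ∈ S, IsTwoShellGoodSet (1 / 16) (9 / 10) 1 S p) (hη : η ≤ 1 / 25)
    (hu : dist (Ψ u) (Φ (f' u)) ≤ η) (hv : dist (Ψ v) (Φ (f' v)) ≤ η) (huv : u ≠ v) : f' u ≠ f' v := by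
  have hne : Ψ v ≠ Ψ u := fun e => huv (hΨ.1 (mem_univ _) (mem_univ _) e).symm
  have hsep := le_dist_of_good (hgoodS _ (hΨ.2.1 (mem_univ u))) (by norm_num) (by norm_num) (by norm_num) (hΨ.2.1 (mem_univ v)) hne
  have hlo : dist (Ψ u) (Ψ v) ≤ dist (Φ (f' u)) (Φ (f' v)) + 2 * η := dist_ge_of_partners hu hv
  intro e
  rw [e, dist_self, dist_comm] at hlo
  norm_num at hsep
  linarith

/-- ★★ **A NEAR INDEX MAP IS A STAR HOMOMORPHISM**: if the sites `Φ (f' u)` are within `η ≤ 1/25` of the atoms `Ψ u` for every `u` in the CLOSED STAR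
of `y` (centre and its twelve links), then `f'` is a star homomorphism at `y` (links bonded to the centre, link adjacency preserved, injective on
links) — so ZZZL's star rigidity and `AgreeStar` continuation apply to `f'` exactly as to the label's index map. [this file, g83] -/
theorem isStarHom_of_near {S C : Set E3} {Ψ Φ : ℤ × ℤ × ℤ → E3} {τS τC : ℤ → Bool} {f' : ℤ × ℤ × ℤ → ℤ × ℤ × ℤ} {y : ℤ × ℤ × ℤ} {η : ℝ}
    (hΨ : IsBarlowBondChart S Set.univ Ψ τS) (hΦ : IsBarlowBondChart C Set.univ Φ τC)
    (hgoodS : ∀ p ∈ S, IsTwoShellGoodSet (1 / 16) (9 / 10) 1 S p) (hgoodC : ∀ c ∈ C, IsTwoShellGoodSet (1 / 15) (8999 / 10000) 1 C c)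
    (hη : η ≤ 1 / 25) (hy : dist (Ψ y) (Φ (f' y)) ≤ η)
    (hlinks : ∀ i, dist (Ψ (linkPt τS y i)) (Φ (f' (linkPt τS y i))) ≤ η) : IsStarHom τS τC f' y := by
  refine ⟨fun i => barlowAdj_of_near hΨ hΦ hgoodS hgoodC hη hy (hlinks i) (barlowAdj_linkPt τS y i),
    fun i j hij => barlowAdj_of_near hΨ hΦ hgoodS hgoodC hη (hlinks i) (hlinks j) hij, fun i j hij => ?_⟩
  by_contra hne
  exact ne_of_near hΨ hgoodS hη (hlinks i) (hlinks j) (fun e => hne (linkPt_injective τS y e)) hij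

/-- the record telescope supplies the goodness hypotheses of §3: `S` is `(1/16, 9/10, 1)`-clean (`IsDoorSetP 1 δ S`), `C = placedCrystal …` is
`(1/15, 8999/10000, 1)`-clean (ZZZN `placedCrystal_good`). [this file, g83] -/
theorem goodS_of_isDoorSetP {δ : ℝ} {S : Set E3} (hS : IsDoorSetP 1 δ S) : ∀ p ∈ S, IsTwoShellGoodSet (1 / 16) (9 / 10) 1 S p :=
  (isCleanP_μS_iff (aHi := 1) S).1 hS.2.2.1

end Summit.AtomisticToContinuum.Crystallization.Theorems.ChartedZeroExcessLayeredLatticeLiouville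

end
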